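import Summits.QuantumAdvantage.QuantumAdvantage.Theorems.CubicForrelationSignedExactCubicForrelationNotPrBPPGrowMachineSteps
import Summits.QuantumAdvantage.QuantumAdvantage.Theorems.CubicForrelationSignedExactCubicForrelationNotPrBPPGrowMachineCoins
import Summits.QuantumAdvantage.QuantumAdvantage.Theorems.CubicForrelationSignedExactCubicForrelationNotPrBPPGrowMachineStages

/-!
# Crux `CubicForrelation.SignedExactCubicForrelationNotPrBPP` (stmt-QuantumAdvantage-13932), line `dual-pingpong-frame`
# (GROW reshape): the GROW machine, XI–XII — the law of the candidate; a trial succeeds with probability `≥ (n+2)⁻⁸`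

Proof-only support file (`--supports stmt-QuantumAdvantage-13932`) toward the registered stub `stub_growFinder`; sequel
of `…GrowMachineSteps.lean`, `…GrowMachineCoins.lean`, `…GrowMachineStages.lean`.

* `uniformProb_cand_mem` — **the law of the `b`-side candidate of job `r`**: for a uniformly random chunk the
  probability that `v = candV n cg S U (first r probes) sel` lands in a finset `G` is
  `(∑_{xs : Fin r → {0,1}ⁿ} |K(xs) ∩ G| / |K(xs)|) / 2^{n r}`, `K(xs)` the line's candidate space: the event reads the
  first `(r+1) n` coins (cylinder rule `uniformProb_take_of_le`), which decode bijectively into `(sel, x₁, …, x_r)`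
  (`chunkVec_bijective`, `uniformProb_eq_card_of_bijective`), and for fixed probes the selector makes `v` uniform on
  `K(xs)` with constant multiplicity (`card_filter_kcV_div`);
* `uniformProb_tryB_ge` — if the line's KERNEL STATISTICS hold on the `g`-side for `r` probes (good fraction
  `≥ 2^{n r} / (n+2)⁸`, "good" = outside `span S` and inside an M-subspace of `g` containing `span S` and orthogonal to
  `span U`) and every M-subspace of `g` gives closed pairs `(V, V^⊥)`, `(V^⊥, V)` (the line's `MPairClosed`), then the
  `b`-side step with `r` probes accepts a uniform chunk with probability `≥ (n+2)⁻⁸` (`tryB_complete` inside the closed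
  orthogonal pair `(V, V^⊥)` of sizes `2^m`, plus the law above).

## References

* S. Arora, B. Barak, *Computational Complexity: A Modern Approach*, CUP 2009, §7.1. [AroraBarak2009]
* C. Carlet, *Boolean Functions for Cryptography and Coding Theory*, CUP 2021, Prop. 54, Prop. 77. [Carlet2020]
* D. E. Knuth, *TAOCP* Vol. 2, 3rd ed., §4.6.2 Algorithm N. [KnuthTAOCP2]
-/

noncomputable section

set_option linter.dupNamespace false -- D-0017: single-problem summit ⇒ `QuantumAdvantage.QuantumAdvantage` by design

namespace Summit.QuantumAdvantage.QuantumAdvantage.Theorems.SignedExactCubicForrelationNotPrBPP.GrowMachine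

open Finset
open Literature.Computability.Complexity Literature.Computability.QuantumComplexity
open Literature.Computability.Complexity.F2Elim
open Literature.Computability.Complexity.BLR (toZ toZ_xor toZ_and toZ_injective)
open Literature.Computability.QuantumComplexity.BuzetChailloux (bxor zeroVec bxor_self bxor_comm bxor_zeroVec zeroVec_bxor)
open PolarGeometry (toZ_bdot bdot_comm bdot_bxor_left bdot_bxor_right twist_eq_one_iff_bdot)
open NoTrap (bdot_zeroVec bdot_unit)
open ForrCode QuadSampler MMReadout CubicDequant
open Literature.Computability.QuantumComplexity (uniformProb_mono_of_length')
open FinderMachine (Vec Mat normV basisOf kerOf inSpan)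

variable {n m : ℕ}

/-! ### The law of the candidate -/

section Law

variable {g : (Fin n → Bool) → Bool} (D : (Fin n → Bool) → (Fin n → Bool) → (Fin n → Bool) → Bool)
  (hD : ∀ u v x, D u v x = (g x ^^ g (bxor x u) ^^ g (bxor x v) ^^ g (bxor x (bxor u v))))
  {cg : PCirc} (hg : ∀ v, evalP cg v = g (toInput n v)) (hg3 : IsDegLeFun 3 g)
include hD hg hg3

/-- **The law of the `b`-side candidate of job `r`.** For a uniform chunk, the probability that the candidate lands in
`G` is `(∑_{xs} |K(xs) ∩ G| / |K(xs)|) / 2^{n r}`, `K(xs)` the line's candidate space. [cite: AroraBarak2009, §7.1] -/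
theorem uniformProb_cand_mem (S U : Mat) {r : ℕ} (hr : r ≤ n + 1) (G : Finset (Fin n → Bool))
    (Kx : (Fin r → (Fin n → Bool)) → Finset (Fin n → Bool))
    (hKx : ∀ xs v, v ∈ Kx xs ↔ (∀ s ∈ spanV n S, ∀ x, D s v x = false) ∧
      (∀ u ∈ spanV n U, (univ.filter fun i => u i && v i).card.bodd = false) ∧
      ∀ j, ∀ y z : Fin n → Bool, (D (xs j) v z ^^ D (xs j) v (bxor z y)) = false) :
    uniformProb (chunkLen n) {c | toInput n (candV n cg S U ((probesOf n c).take r) (selOf n c)) ∈ G} =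
      (∑ xs : Fin r → (Fin n → Bool), (((Kx xs).filter fun v => v ∈ G).card : ℝ) / (Kx xs).card) / (2 : ℝ) ^ (n * r) := by
  classical
  set K := (r + 1) * n with hK
  set E : Set (List Bool) := {c | toInput n (candV n cg S U ((probesOf n c).take r) (selOf n c)) ∈ G} with hE
  -- the event only reads the first `(r+1) n` coins
  have hKC : K ≤ chunkLen n := by rw [hK, chunkLen]; exact Nat.mul_le_mul_right n (by omega)
  have h1 : uniformProb (chunkLen n) E = uniformProb K E := by
    rw [← uniformProb_take_of_le hKC E]
    congr 1
    ext c
    simp only [hE, Set.mem_setOf_eq]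
    rw [(cand_take hr c).1, (cand_take hr c).2]
  -- decode the prefix into `(sel, x₁, …, x_r)`
  set X := List.Vector Bool n
  set Q : (Fin (r + 1) → X) → Prop := fun F =>
    toInput n (candV n cg S U (List.ofFn fun j : Fin r => (F j.succ).toList) (F 0).toList) ∈ G with hQ
  have h2 : uniformProb K E = ((univ.filter Q).card : ℝ) / Fintype.card (Fin (r + 1) → X) := by
    rw [← uniformProb_eq_card_of_bijective (chunkVec (J := r + 1) (A := n)) (chunkVec_bijective (r + 1) n) Q]
    refine uniformProb_congr fun w hw => ?_
    simp only [hE, hQ, Set.mem_setOf_eq]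
    rw [(cand_blocks hr hw).1, (cand_blocks hr hw).2]
    exact ⟨fun h => ⟨hw, h⟩, fun ⟨_, h⟩ => h⟩
  -- split off the selector and count fibrewise over the probes
  set Q' : X → (Fin r → X) → Prop := fun x0 Gp =>
    toInput n (candV n cg S U (List.ofFn fun j : Fin r => (Gp j).toList) x0.toList) ∈ G with hQ'
  have h3 : ((univ.filter Q).card : ℝ) = ∑ Gp : Fin r → X, ((univ.filter fun x0 : X => Q' x0 Gp).card : ℝ) := by
    have e1 : (univ.filter Q).card = (univ.filter fun q : X × (Fin r → X) => Q' q.1 q.2).card := by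
      refine card_equiv (Fin.consEquiv fun _ => X).symm fun F => ?_
      simp only [mem_filter, mem_univ, true_and]
      rfl
    rw [e1, card_filter, Fintype.sum_prod_type, sum_comm]
    push_cast
    refine sum_congr rfl fun Gp _ => ?_
    rw [card_filter]; push_cast; rfl
  -- for fixed probes the selector is uniform on `K(xs)` with constant multiplicity
  have h4 : ∀ Gp : Fin r → X, ((univ.filter fun x0 : X => Q' x0 Gp).card : ℝ) / (2 : ℝ) ^ n =
      (((Kx (fun j => Equiv.vectorEquivFin Bool n (Gp j))).filter fun v => v ∈ G).card : ℝ) /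
        (Kx (fun j => Equiv.vectorEquivFin Bool n (Gp j))).card := by
    intro Gp
    set xsL : Mat := List.ofFn fun j : Fin r => (Gp j).toList with hxsL
    have hKG : ∀ v, v ∈ Kx (fun j => Equiv.vectorEquivFin Bool n (Gp j)) ↔ bz v ∈ kerSet n (candK n cg S U xsL) := by
      intro v
      rw [hKx, bz_mem_kerSet_candK_iff D hD hg hg3, hxsL, List.forall_mem_ofFn_iff]
      simp only [toInput_toList]
    rw [← card_filter_kcV_div _ hKG G]
    congr 2
    refine card_equiv (Equiv.vectorEquivFin Bool n) fun x0 => ?_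
    simp only [mem_filter, mem_univ, true_and, hQ']
    rw [toInput_candV _ _ _ (x0.toList_length), toInput_toList]
  -- assemble
  have hcard : (Fintype.card (Fin (r + 1) → X) : ℝ) = (2 : ℝ) ^ n * (2 : ℝ) ^ (n * r) := by
    rw [Fintype.card_fun, Fintype.card_fin, card_vector, Fintype.card_bool]
    push_cast
    rw [← pow_mul, ← pow_add]
    congr 1; ring
  rw [h1, h2, h3, hcard, ← div_div, sum_div]
  congr 1
  refine Fintype.sum_equiv (Equiv.piCongrRight fun _ : Fin r => Equiv.vectorEquivFin Bool n) _ _ fun Gp => ?_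
  rw [h4 Gp]
  rfl

end Law


/-! ### The orthogonal of an M-subspace -/

/-- A finset with `|V|² = 2^{2m}` has `2^m` elements. [folklore] -/
theorem card_eq_of_sq {V : Finset (Fin n → Bool)} (hn : n = m + m) (h : ((V.card : ℝ)) ^ 2 = (2 : ℝ) ^ n) : V.card = 2 ^ m := by
  have h2 : (2 : ℝ) ^ n = ((2 : ℝ) ^ m) ^ 2 := by rw [hn, ← pow_mul]; ring_nf
  rw [h2] at h
  have := (pow_left_inj₀ (by positivity) (by positivity) two_ne_zero).1 h
  exact_mod_cast this

/-- **The orthogonal of a half-dimensional subspace**: it contains `0`, is closed under `⊕`, is orthogonal to `V`, and has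
`2^m` elements. [cite: Carlet2020, Prop. 77] -/
theorem perpB_props {V : Finset (Fin n → Bool)} (hn : n = m + m) (hV0 : zeroVec ∈ V) (hVadd : ∀ x ∈ V, ∀ y ∈ V, bxor x y ∈ V)
    (hVc : ((V.card : ℝ)) ^ 2 = (2 : ℝ) ^ n) :
    zeroVec ∈ (univ.filter fun y : Fin n → Bool => ∀ s ∈ V, (univ.filter fun i => s i && y i).card.bodd = false) ∧
    (∀ x ∈ (univ.filter fun y : Fin n → Bool => ∀ s ∈ V, (univ.filter fun i => s i && y i).card.bodd = false),
      ∀ y ∈ (univ.filter fun y : Fin n → Bool => ∀ s ∈ V, (univ.filter fun i => s i && y i).card.bodd = false),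
        bxor x y ∈ (univ.filter fun y : Fin n → Bool => ∀ s ∈ V, (univ.filter fun i => s i && y i).card.bodd = false)) ∧
    (∀ s ∈ V, ∀ u ∈ (univ.filter fun y : Fin n → Bool => ∀ s ∈ V, (univ.filter fun i => s i && y i).card.bodd = false),
      (univ.filter fun i => s i && u i).card.bodd = false) ∧
    (univ.filter fun y : Fin n → Bool => ∀ s ∈ V, (univ.filter fun i => s i && y i).card.bodd = false).card = 2 ^ m := by
  refine ⟨mem_filter.2 ⟨mem_univ _, fun s _ => bdot_zeroVec s⟩, fun x hx y hy => mem_filter.2 ⟨mem_univ _, fun s hs => ?_⟩,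
    fun s hs u hu => (mem_filter.1 hu).2 s hs, ?_⟩
  · rw [bdot_bxor_right, (mem_filter.1 hx).2 s hs, (mem_filter.1 hy).2 s hs]; rfl
  · have h := (DerivativeWalsh.perp_perp_eq_of_sq hV0 hVadd hVc).2
    rw [MPair.perp_twist_eq_perp_bdot, card_eq_of_sq hn hVc] at h
    exact_mod_cast h

/-! ### The `b`-side step succeeds with probability `≥ (n+2)⁻⁸` -/

section TryB

variable {f g : (Fin n → Bool) → Bool} (Df Dg : (Fin n → Bool) → (Fin n → Bool) → (Fin n → Bool) → Bool)
  (hDf : ∀ u v x, Df u v x = (f x ^^ f (bxor x u) ^^ f (bxor x v) ^^ f (bxor x (bxor u v))))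
  (hDg : ∀ u v x, Dg u v x = (g x ^^ g (bxor x u) ^^ g (bxor x v) ^^ g (bxor x (bxor u v))))
  {cf cg : PCirc} (hf : ∀ v, evalP cf v = f (toInput n v)) (hg : ∀ v, evalP cg v = g (toInput n v))
  (hf3 : IsDegLeFun 3 f) (hg3 : IsDegLeFun 3 g)
  (Clf Clg : Finset (Fin n → Bool) → Finset (Fin n → Bool) → Prop)
  (hClf : ∀ A B, Clf A B ↔
    ((∀ s ∈ A, ∀ y : Fin n → Bool, (fun k => (Df s y zeroVec ^^ Df s y (fun j => decide (j = k)))) ∈ B) ∧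
     (∀ s ∈ A, ∃ ℓ ∈ B, ∀ r : Fin n → Bool, (∀ y z : Fin n → Bool, (Df s r z ^^ Df s r (bxor z y)) = false) →
        Df s r zeroVec = (univ.filter fun i => ℓ i && r i).card.bodd)))
  (hClg : ∀ A B, Clg A B ↔
    ((∀ s ∈ A, ∀ y : Fin n → Bool, (fun k => (Dg s y zeroVec ^^ Dg s y (fun j => decide (j = k)))) ∈ B) ∧
     (∀ s ∈ A, ∃ ℓ ∈ B, ∀ r : Fin n → Bool, (∀ y z : Fin n → Bool, (Dg s r z ^^ Dg s r (bxor z y)) = false) →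
        Dg s r zeroVec = (univ.filter fun i => ℓ i && r i).card.bodd)))
  (Inv : Mat × Mat → Prop)
  (hInv : ∀ p, Inv p ↔
    ((spanV n p.1).card = 2 ^ p.1.length ∧ (spanV n p.2).card = 2 ^ p.2.length) ∧ (p.1.length ≤ m ∧ p.2.length ≤ m) ∧
      Clg (spanV n p.1) (spanV n p.2) ∧ Clf (spanV n p.2) (spanV n p.1) ∧
      ∀ s ∈ spanV n p.1, ∀ u ∈ spanV n p.2, (univ.filter fun i => s i && u i).card.bodd = false)
  -- M-pairs of `g` are closed (the line's `MPairClosed`, `g`-side instance)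
  (hMP : ∀ V : Finset (Fin n → Bool),
    ((zeroVec ∈ V ∧ ∀ x ∈ V, ∀ y ∈ V, bxor x y ∈ V) ∧ (((V.card : ℝ)) ^ 2 = (2 : ℝ) ^ n) ∧ ∀ u ∈ V, ∀ v ∈ V, ∀ x, Dg u v x = false) →
      Clg V (univ.filter fun y : Fin n → Bool => ∀ s ∈ V, (univ.filter fun i => s i && y i).card.bodd = false) ∧
      Clf (univ.filter fun y : Fin n → Bool => ∀ s ∈ V, (univ.filter fun i => s i && y i).card.bodd = false) V)

include hDf hDg hf hg hf3 hg3 hClf hClg hInv hMP in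
/-- **The `b`-side step with `r` probes accepts with probability `≥ (n+2)⁻⁸`** when the kernel statistics hold for `r`.
[cite: AroraBarak2009, §7.1] -/
theorem uniformProb_tryB_ge (hn : n = m + m) {p : Mat × Mat} (hp : Inv p) {r : ℕ} (hr : r ≤ n + 1)
    (Gd : Finset (Fin n → Bool))
    (hGd : ∀ v, v ∈ Gd ↔ v ∉ spanV n p.1 ∧ ∃ V : Finset (Fin n → Bool),
      ((zeroVec ∈ V ∧ ∀ x ∈ V, ∀ y ∈ V, bxor x y ∈ V) ∧ (((V.card : ℝ)) ^ 2 = (2 : ℝ) ^ n) ∧ ∀ u ∈ V, ∀ v ∈ V, ∀ x, Dg u v x = false) ∧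
      spanV n p.1 ⊆ V ∧ v ∈ V ∧ ∀ s ∈ V, ∀ u ∈ spanV n p.2, (univ.filter fun i => s i && u i).card.bodd = false)
    (Kx : (Fin r → (Fin n → Bool)) → Finset (Fin n → Bool))
    (hKx : ∀ xs v, v ∈ Kx xs ↔ (∀ s ∈ spanV n p.1, ∀ x, Dg s v x = false) ∧
      (∀ u ∈ spanV n p.2, (univ.filter fun i => u i && v i).card.bodd = false) ∧
      ∀ j, ∀ y z : Fin n → Bool, (Dg (xs j) v z ^^ Dg (xs j) v (bxor z y)) = false)
    (hmass : (2 : ℝ) ^ (n * r) / ((n : ℝ) + 2) ^ 8 ≤ ∑ xs : Fin r → (Fin n → Bool), (((Kx xs).filter fun v => v ∈ Gd).card : ℝ) / (Kx xs).card) :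
    1 / ((n : ℝ) + 2) ^ 8 ≤ uniformProb (chunkLen n) {c | ∃ q, tryB n m cf cg p ((probesOf n c).take r) (selOf n c) = some q} := by
  have hsub : ∀ c : List Bool, toInput n (candV n cg p.1 p.2 ((probesOf n c).take r) (selOf n c)) ∈ Gd →
      ∃ q, tryB n m cf cg p ((probesOf n c).take r) (selOf n c) = some q := by
    intro c hc
    obtain ⟨hvS, V, hMV, hSV, hvV, hVU⟩ := (hGd _).1 hc
    obtain ⟨⟨hV0, hVadd⟩, hVc, -⟩ := id hMV
    obtain ⟨hW0, hWadd, hVW, hWc⟩ := perpB_props hn hV0 hVadd hVc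
    obtain ⟨hgVW, hfWV⟩ := hMP V hMV
    refine tryB_complete Df Dg hDf hDg hf hg hf3 hg3 Clf Clg hClf hClg Inv hInv hn hp hV0 hVadd hW0 hWadd
      (card_eq_of_sq hn hVc) hWc hgVW hfWV hVW hSV (fun u hu => mem_filter.2 ⟨mem_univ _, fun s hs => hVU s hs u hu⟩) hvV hvS
  have hlaw := uniformProb_cand_mem Dg hDg hg hg3 p.1 p.2 hr Gd Kx hKx
  have hpos : (0 : ℝ) < (2 : ℝ) ^ (n * r) := by positivity
  calc 1 / ((n : ℝ) + 2) ^ 8 = ((2 : ℝ) ^ (n * r) / ((n : ℝ) + 2) ^ 8) / (2 : ℝ) ^ (n * r) := by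
        field_simp
    _ ≤ (∑ xs : Fin r → (Fin n → Bool), (((Kx xs).filter fun v => v ∈ Gd).card : ℝ) / (Kx xs).card) / (2 : ℝ) ^ (n * r) :=
        div_le_div_of_nonneg_right hmass hpos.le
    _ = uniformProb (chunkLen n) {c | toInput n (candV n cg p.1 p.2 ((probesOf n c).take r) (selOf n c)) ∈ Gd} := hlaw.symm
    _ ≤ _ := uniformProb_mono_of_length' fun c _ hc => hsub c hc

end TryB

/-- **A finset with `|V|² = 2^{2m}` has `2^m` elements** (registered brick `grow_cardOfSq` of stub `stub_growFinder`, line `dual-pingpong-frame`, crux stmt-QuantumAdvantage-13932). [folklore] -/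
theorem grow_cardOfSq : ∀ {n m : ℕ} {V : Finset (Fin n → Bool)}, n = m + m → ((V.card : ℝ)) ^ 2 = (2 : ℝ) ^ n → V.card = 2 ^ m :=
  fun hn h => card_eq_of_sq hn h

end Summit.QuantumAdvantage.QuantumAdvantage.Theorems.SignedExactCubicForrelationNotPrBPP.GrowMachine

end
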